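/-
Copyright (c) 2026 the pub-hodgecm-mathlib formalisation cell (harness21).  Prover seat hodgecm-mathlib-A-p14 (g32), organ A-75 of the road «S3-tree»
(architect A-p16 (g29), HAND WANTED 2026-09-01T17:17:45Z), 2026-09-01.
-/
import Mathlib.Algebra.Group.Conj
import Mathlib.Algebra.Group.Subgroup.Basic
import Mathlib.GroupTheory.QuotientGroup.Defs
import Mathlib.Algebra.BigOperators.Pi
import Mathlib.Algebra.BigOperators.Finprod
import Mathlib.Algebra.Group.Indicator
import Mathlib.Topology.Algebra.OpenSubgroup
import Mathlib.Topology.Algebra.Support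
import Mathlib.Topology.LocallyConstant.Basic
import Mathlib.Tactic.Group
import HarnessLib

/-!
# CLASS DECOMPOSITION: a function supported in `K`, right-`N`-invariant and `Ad(K)`-invariant, is the finite linear combination of the indicators of the
# `N`-saturated `K`-conjugacy classes (the classes of the finite group `K ⧸ N` pulled back to `K`)

Topic `GroupTheory`; namespace `Literature.GroupTheory`.  THEOREMS ONLY (no definition, no instance, no notation, no named fact, no `sorry`); folklore
([SerreLinearRepresentations1977] §2.1 ∕ §2.5: the indicator functions of the conjugacy classes of a finite group are a basis of its class functions; pulled back
along `K → K ⧸ N` for an open normal subgroup `N` of a compact open `K`: [BernsteinZelevinsky1976] §1.1, [CartierCorvallis1979] §1.1).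
Cell `pub/hodgecm-mathlib` (D-0151), crux H413 = `stmt-HodgeConjecture-24833`, road «S3-tree» (LEAD F0P3a-plan (g11) WORD T10-2), architect ruling **A-75
«CLASS-DECOMPOSITION organ»** for the END fold: ★ «SPAN» (`Rogawski1990/UnitaryVertexStabilizerSpanCM`) produces ARBITRARY `Ad(K)`-invariant level-`j` pieces
`ψ` on a hyperspecial `K` (right-invariant under the level subgroup `N = K_j`), while the GEN-χ heads (A-68) are stated PER CLASS `C` of `K ⧸ K_j`; this file is the
bookkeeping `ψ = Σ_C ψ(C) · 1_C`, after which ★ finite additivity of regular orbital integrals (`classOrbitalIntegral_finset_sum_of_isLocSmooth`) gives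
`Φ(c, ψ) = Σ_C ψ(C) · Φ(c, 1_C)`.  `--supports stmt-HodgeConjecture-24833`; COUNT-NEUTRAL.
HONEST LABEL: HC_CM is proved only modulo the printed citations (2 remaining named inputs hLiu418 24832, h413 24833) until rung 0 closes; this file is pure
group theory and pays no letter.

THE MATHEMATICS.  `G` a group, `N ≤ K` subgroups of `G` with `N` normalised by `K` (i.e. `N′ := N.subgroupOf K` is normal in `K`; Mathlib
`Subgroup.normal_subgroupOf_iff`).  For a conjugacy class `t` of the quotient group `K ⧸ N′` put (INLINE everywhere below, no definition)
  `S t := {x : G | ∃ h : x ∈ K, ConjClasses.mk (↑⟨x, h⟩ : K ⧸ N′) = t}`   — the `N`-SATURATED `K`-CONJUGACY CLASS over `t`,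
  `rep t := ((Quotient.out (Quotient.out t) : K) : G)`                   — a representative (`rep t ∈ S t`).
(§1) `S t ⊆ K`; the `S t` are pairwise disjoint with union `K`; `x, y ∈ K` lie in the same `S t` iff `y = k x k⁻¹ n` with `k ∈ K`, `n ∈ N`; each `S t` is
right- and left-`N`-stable and `Ad(K)`-stable; `rep t ∈ S t`.  (§2) If `f : G → R` is right-`N`-invariant and `Ad(K)`-invariant then `f` is CONSTANT on each
`S t`; if moreover `support f ⊆ K` then POINTWISE `f x = ∑ᶠ t, f (rep t) * 1_{S t}(x)` (no finiteness needed: at most one term is non-zero), and when the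
classes are finitely indexed (`[Fintype (ConjClasses (K ⧸ N′))]`, e.g. `K ⧸ N′` finite) the FUNCTION identity `f = Σ_t f (rep t) • 1_{S t}` holds for ANY
system of representatives; the coefficients are recovered by evaluation (`(Σ_t c_t • 1_{S t}) x = c_t` for `x ∈ S t`), and each `1_{S t}` is itself supported in
`K`, right-`N`-invariant and `Ad(K)`-invariant.  (§3) Topology (`G` a topological group): if `N` is OPEN then every `S t` is CLOPEN (open: `x·N ⊆ S t`; closed:
`K` is an open hence closed subgroup and `S t = K ∖ ⋃_{t′ ≠ t} S t′`), hence `1_{S t}` is LOCALLY CONSTANT; if moreover `K` is COMPACT then `S t` is compact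
and `1_{S t}` has COMPACT SUPPORT — so the pieces are in `C_c^∞(G)` (consumers: ★ `isLocSmooth_indicator_of_isClopen`).

* §1 `subset_of_mem_satClass`, `mem_satClass_of_mem`, `mk_eq_mk_iff_exists_conj_mul`, `mem_satClass_iff_exists_conj_mul`, `eq_of_mem_satClass_of_mem_satClass`,
  `disjoint_satClass`, `iUnion_satClass_eq`, `mul_mem_satClass`, `mul_mem_satClass'`, `conj_mem_satClass`, `out_out_mem_satClass`, `satClass_nonempty`,
  `exists_mem_mk_eq`.
* §2 `apply_eq_apply_of_mem_satClass`, `apply_eq_apply_out_out`, `indicator_satClass_apply_of_mem`, `indicator_satClass_apply_of_notMem`,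
  `sum_smul_indicator_satClass_apply`, `sum_smul_indicator_satClass_apply_of_notMem`, **`eq_finsum_indicator_satClass_apply`**,
  **`eq_sum_smul_indicator_satClass_of_forall_mem`**, **`eq_sum_smul_indicator_satClass`** (the head, A-75 verbatim), `support_indicator_satClass_subset`,
  `indicator_satClass_mul_right`, `indicator_satClass_conj`.
* §3 `isOpen_satClass`, `isClosed_satClass`, `isClopen_satClass`, `isCompact_satClass`, `isLocallyConstant_indicator_const_of_isClopen`,
  `isLocallyConstant_indicator_satClass`, `hasCompactSupport_indicator_satClass`.

## References
* [SerreLinearRepresentations1977] J.-P. Serre, *Linear Representations of Finite Groups*, GTM 42 (1977): §2.1, §2.5 (class functions; the class indicators).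
* [BernsteinZelevinsky1976] I. N. Bernstein, A. V. Zelevinsky, *Representations of the group GL(n, F) where F is a non-archimedean local field*, Russian Math.
  Surveys 31 (1976): §1.1 (locally constant compactly supported functions, congruence-level invariance).
* [CartierCorvallis1979] P. Cartier, *Representations of p-adic groups: a survey*, Proc. Sympos. Pure Math. 33 Part 1 (1979): §1.1 p. 112.
-/

set_option autoImplicit false

open Set Function

namespace Literature.GroupTheory

variable {G : Type*} [Group G] {K N : Subgroup G}

/-! ## §1 The `N`-saturated `K`-conjugacy classes -/

section Classes

variable [hN : (N.subgroupOf K).Normal]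

/-- `S t ⊆ K`: a member of the saturated class over `t` lies in `K`. [cite: SerreLinearRepresentations1977, §2.1] -/
theorem subset_of_mem_satClass (t : ConjClasses (K ⧸ N.subgroupOf K)) :
    {x : G | ∃ h : x ∈ K, ConjClasses.mk ((⟨x, h⟩ : K) : K ⧸ N.subgroupOf K) = t} ⊆ (K : Set G) :=
  fun _ hx => hx.1

/-- Every `x ∈ K` lies in the saturated class over the class of its image in `K ⧸ N′`. [cite: SerreLinearRepresentations1977, §2.1] -/
theorem mem_satClass_of_mem {x : G} (hx : x ∈ K) :
    x ∈ {y : G | ∃ h : y ∈ K, ConjClasses.mk ((⟨y, h⟩ : K) : K ⧸ N.subgroupOf K) =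
      ConjClasses.mk ((⟨x, hx⟩ : K) : K ⧸ N.subgroupOf K)} :=
  ⟨hx, rfl⟩

/-- Two elements `x, y ∈ K` have conjugate images in `K ⧸ N′` iff `y = k * x * k⁻¹ * n` for some `k ∈ K`, `n ∈ N`.
[cite: SerreLinearRepresentations1977, §2.1] -/
theorem mk_eq_mk_iff_exists_conj_mul {x y : G} (hx : x ∈ K) (hy : y ∈ K) :
    ConjClasses.mk ((⟨x, hx⟩ : K) : K ⧸ N.subgroupOf K) = ConjClasses.mk ((⟨y, hy⟩ : K) : K ⧸ N.subgroupOf K) ↔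
      ∃ k ∈ K, ∃ n ∈ N, y = k * x * k⁻¹ * n := by
  rw [ConjClasses.mk_eq_mk_iff_isConj, isConj_iff]
  constructor
  · rintro ⟨c, hc⟩
    induction c using QuotientGroup.induction_on with
    | H k =>
      rw [← QuotientGroup.mk_mul, ← QuotientGroup.mk_inv, ← QuotientGroup.mk_mul, QuotientGroup.eq, Subgroup.mem_subgroupOf] at hc
      refine ⟨k, k.2, ((k : G) * x * (k : G)⁻¹)⁻¹ * y, ?_, ?_⟩
      · convert hc using 1
        push_cast
        group
      · group
  · rintro ⟨k, hk, n, hn, rfl⟩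
    refine ⟨((⟨k, hk⟩ : K) : K ⧸ N.subgroupOf K), ?_⟩
    rw [← QuotientGroup.mk_mul, ← QuotientGroup.mk_inv, ← QuotientGroup.mk_mul, QuotientGroup.eq, Subgroup.mem_subgroupOf]
    convert hn using 1
    push_cast
    group

/-- Membership in a saturated class, for `x ∈ K` (with `N ≤ K`): `y ∈ S (class of x̄)` iff `y = k * x * k⁻¹ * n` with `k ∈ K`, `n ∈ N`.
[cite: SerreLinearRepresentations1977, §2.1] -/
theorem mem_satClass_iff_exists_conj_mul (hNK : N ≤ K) {x : G} (hx : x ∈ K) (y : G) :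
    y ∈ {z : G | ∃ h : z ∈ K, ConjClasses.mk ((⟨z, h⟩ : K) : K ⧸ N.subgroupOf K) =
      ConjClasses.mk ((⟨x, hx⟩ : K) : K ⧸ N.subgroupOf K)} ↔ ∃ k ∈ K, ∃ n ∈ N, y = k * x * k⁻¹ * n := by
  constructor
  · rintro ⟨hy, h⟩
    exact (mk_eq_mk_iff_exists_conj_mul hx hy).1 h.symm
  · rintro ⟨k, hk, n, hn, rfl⟩
    have hy : k * x * k⁻¹ * n ∈ K := K.mul_mem (K.mul_mem (K.mul_mem hk hx) (K.inv_mem hk)) (hNK hn)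
    exact ⟨hy, ((mk_eq_mk_iff_exists_conj_mul hx hy).2 ⟨k, hk, n, hn, rfl⟩).symm⟩

/-- If `x` lies in the saturated classes over `t` and over `t'` then `t = t'`. [cite: SerreLinearRepresentations1977, §2.1] -/
theorem eq_of_mem_satClass_of_mem_satClass {t t' : ConjClasses (K ⧸ N.subgroupOf K)} {x : G}
    (ht : x ∈ {y : G | ∃ h : y ∈ K, ConjClasses.mk ((⟨y, h⟩ : K) : K ⧸ N.subgroupOf K) = t})
    (ht' : x ∈ {y : G | ∃ h : y ∈ K, ConjClasses.mk ((⟨y, h⟩ : K) : K ⧸ N.subgroupOf K) = t'}) : t = t' := by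
  obtain ⟨_, rfl⟩ := ht
  obtain ⟨_, rfl⟩ := ht'
  rfl

/-- The saturated classes are PAIRWISE DISJOINT. [cite: SerreLinearRepresentations1977, §2.1] -/
theorem disjoint_satClass {t t' : ConjClasses (K ⧸ N.subgroupOf K)} (htt' : t ≠ t') :
    Disjoint {x : G | ∃ h : x ∈ K, ConjClasses.mk ((⟨x, h⟩ : K) : K ⧸ N.subgroupOf K) = t}
      {x : G | ∃ h : x ∈ K, ConjClasses.mk ((⟨x, h⟩ : K) : K ⧸ N.subgroupOf K) = t'} :=
  Set.disjoint_left.2 fun _ hx hx' => htt' (eq_of_mem_satClass_of_mem_satClass hx hx')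

/-- The saturated classes COVER `K`: `⋃ t, S t = K`. [cite: SerreLinearRepresentations1977, §2.1] -/
theorem iUnion_satClass_eq :
    (⋃ t : ConjClasses (K ⧸ N.subgroupOf K), {x : G | ∃ h : x ∈ K, ConjClasses.mk ((⟨x, h⟩ : K) : K ⧸ N.subgroupOf K) = t}) = (K : Set G) := by
  ext x
  simp only [Set.mem_iUnion, Set.mem_setOf_eq, SetLike.mem_coe]
  exact ⟨fun ⟨_, hx, _⟩ => hx, fun hx => ⟨_, hx, rfl⟩⟩

/-- Each saturated class is RIGHT-`N`-STABLE (`N ≤ K`): `x ∈ S t → n ∈ N → x * n ∈ S t`. [cite: SerreLinearRepresentations1977, §2.1] -/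
theorem mul_mem_satClass (hNK : N ≤ K) {t : ConjClasses (K ⧸ N.subgroupOf K)} {x n : G}
    (hx : x ∈ {y : G | ∃ h : y ∈ K, ConjClasses.mk ((⟨y, h⟩ : K) : K ⧸ N.subgroupOf K) = t}) (hn : n ∈ N) :
    x * n ∈ {y : G | ∃ h : y ∈ K, ConjClasses.mk ((⟨y, h⟩ : K) : K ⧸ N.subgroupOf K) = t} := by
  obtain ⟨hxK, rfl⟩ := hx
  refine ⟨K.mul_mem hxK (hNK hn), ?_⟩
  refine ((mk_eq_mk_iff_exists_conj_mul hxK _).2 ⟨1, K.one_mem, n, hn, by group⟩).symm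

/-- Each saturated class is LEFT-`N`-STABLE (`N ≤ K`, `N` normalised by `K`): `x ∈ S t → n ∈ N → n * x ∈ S t`.
[cite: SerreLinearRepresentations1977, §2.1] -/
theorem mul_mem_satClass' (hNK : N ≤ K) {t : ConjClasses (K ⧸ N.subgroupOf K)} {x n : G}
    (hx : x ∈ {y : G | ∃ h : y ∈ K, ConjClasses.mk ((⟨y, h⟩ : K) : K ⧸ N.subgroupOf K) = t}) (hn : n ∈ N) :
    n * x ∈ {y : G | ∃ h : y ∈ K, ConjClasses.mk ((⟨y, h⟩ : K) : K ⧸ N.subgroupOf K) = t} := by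
  obtain ⟨hxK, rfl⟩ := hx
  have hn' : x⁻¹ * n * x⁻¹⁻¹ ∈ N := (Subgroup.normal_subgroupOf_iff hNK).1 hN n x⁻¹ hn (K.inv_mem hxK)
  have h := mul_mem_satClass (t := ConjClasses.mk ((⟨x, hxK⟩ : K) : K ⧸ N.subgroupOf K)) hNK ⟨hxK, rfl⟩ hn'
  have hx_eq : x * (x⁻¹ * n * x⁻¹⁻¹) = n * x := by group
  rwa [hx_eq] at h

/-- Each saturated class is `Ad(K)`-STABLE: `x ∈ S t → k ∈ K → k * x * k⁻¹ ∈ S t`. [cite: SerreLinearRepresentations1977, §2.1] -/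
theorem conj_mem_satClass {t : ConjClasses (K ⧸ N.subgroupOf K)} {x k : G}
    (hx : x ∈ {y : G | ∃ h : y ∈ K, ConjClasses.mk ((⟨y, h⟩ : K) : K ⧸ N.subgroupOf K) = t}) (hk : k ∈ K) :
    k * x * k⁻¹ ∈ {y : G | ∃ h : y ∈ K, ConjClasses.mk ((⟨y, h⟩ : K) : K ⧸ N.subgroupOf K) = t} := by
  obtain ⟨hxK, rfl⟩ := hx
  refine ⟨K.mul_mem (K.mul_mem hk hxK) (K.inv_mem hk), ?_⟩
  exact ((mk_eq_mk_iff_exists_conj_mul hxK _).2 ⟨k, hk, 1, N.one_mem, by group⟩).symm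

/-- The canonical representative `rep t := ↑(Quotient.out (Quotient.out t))` lies in the saturated class over `t`.
[cite: SerreLinearRepresentations1977, §2.1] -/
theorem out_out_mem_satClass (t : ConjClasses (K ⧸ N.subgroupOf K)) :
    ((Quotient.out (Quotient.out t) : K) : G) ∈
      {y : G | ∃ h : y ∈ K, ConjClasses.mk ((⟨y, h⟩ : K) : K ⧸ N.subgroupOf K) = t} := by
  refine ⟨(Quotient.out (Quotient.out t) : K).2, ?_⟩
  rw [Subtype.coe_eta, QuotientGroup.out_eq']
  exact Quotient.out_eq t

/-- Each saturated class is NONEMPTY. [cite: SerreLinearRepresentations1977, §2.1] -/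
theorem satClass_nonempty (t : ConjClasses (K ⧸ N.subgroupOf K)) :
    {y : G | ∃ h : y ∈ K, ConjClasses.mk ((⟨y, h⟩ : K) : K ⧸ N.subgroupOf K) = t}.Nonempty :=
  ⟨_, out_out_mem_satClass t⟩

/-- Every saturated class is `S (class of x̄)` for some `x ∈ K`. [cite: SerreLinearRepresentations1977, §2.1] -/
theorem exists_mem_mk_eq (t : ConjClasses (K ⧸ N.subgroupOf K)) :
    ∃ (x : G) (hx : x ∈ K), ConjClasses.mk ((⟨x, hx⟩ : K) : K ⧸ N.subgroupOf K) = t :=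
  ⟨_, out_out_mem_satClass t |>.1, (out_out_mem_satClass t).2⟩

end Classes

/-! ## §2 Class functions: constancy on saturated classes and the decomposition -/

section Decomposition

variable [hN : (N.subgroupOf K).Normal] {R : Type*}

/-- A right-`N`-invariant, `Ad(K)`-invariant function is CONSTANT on each saturated class. [cite: SerreLinearRepresentations1977, §2.5] -/
theorem apply_eq_apply_of_mem_satClass {f : G → R} (hright : ∀ n ∈ N, ∀ x, f (x * n) = f x)
    (hAd : ∀ k ∈ K, ∀ x, f (k * x * k⁻¹) = f x) {t : ConjClasses (K ⧸ N.subgroupOf K)} {x y : G}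
    (hx : x ∈ {z : G | ∃ h : z ∈ K, ConjClasses.mk ((⟨z, h⟩ : K) : K ⧸ N.subgroupOf K) = t})
    (hy : y ∈ {z : G | ∃ h : z ∈ K, ConjClasses.mk ((⟨z, h⟩ : K) : K ⧸ N.subgroupOf K) = t}) : f x = f y := by
  obtain ⟨hxK, rfl⟩ := hx
  obtain ⟨hyK, h⟩ := hy
  obtain ⟨k, hk, n, hn, rfl⟩ := (mk_eq_mk_iff_exists_conj_mul hxK hyK).1 h.symm
  rw [hright n hn, hAd k hk]

/-- In particular `f x = f (rep t)` for `x ∈ S t`. [cite: SerreLinearRepresentations1977, §2.5] -/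
theorem apply_eq_apply_out_out {f : G → R} (hright : ∀ n ∈ N, ∀ x, f (x * n) = f x)
    (hAd : ∀ k ∈ K, ∀ x, f (k * x * k⁻¹) = f x) {t : ConjClasses (K ⧸ N.subgroupOf K)} {x : G}
    (hx : x ∈ {z : G | ∃ h : z ∈ K, ConjClasses.mk ((⟨z, h⟩ : K) : K ⧸ N.subgroupOf K) = t}) :
    f x = f ((Quotient.out (Quotient.out t) : K) : G) :=
  apply_eq_apply_of_mem_satClass hright hAd hx (out_out_mem_satClass t)

variable [Semiring R]

/-- Indicator bookkeeping (1): for `x ∈ S t`, `1_{S t} x = 1`. [cite: SerreLinearRepresentations1977, §2.1] -/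
theorem indicator_satClass_apply_of_mem {t : ConjClasses (K ⧸ N.subgroupOf K)} {x : G}
    (hx : x ∈ {z : G | ∃ h : z ∈ K, ConjClasses.mk ((⟨z, h⟩ : K) : K ⧸ N.subgroupOf K) = t}) :
    {z : G | ∃ h : z ∈ K, ConjClasses.mk ((⟨z, h⟩ : K) : K ⧸ N.subgroupOf K) = t}.indicator (1 : G → R) x = 1 := by
  rw [Set.indicator_of_mem hx, Pi.one_apply]

/-- Indicator bookkeeping (2): for `x ∈ S t` and `t' ≠ t`, `1_{S t'} x = 0`. [cite: SerreLinearRepresentations1977, §2.1] -/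
theorem indicator_satClass_apply_of_mem_of_ne {t t' : ConjClasses (K ⧸ N.subgroupOf K)} {x : G}
    (hx : x ∈ {z : G | ∃ h : z ∈ K, ConjClasses.mk ((⟨z, h⟩ : K) : K ⧸ N.subgroupOf K) = t}) (ht' : t' ≠ t) :
    {z : G | ∃ h : z ∈ K, ConjClasses.mk ((⟨z, h⟩ : K) : K ⧸ N.subgroupOf K) = t'}.indicator (1 : G → R) x = 0 :=
  Set.indicator_of_notMem (fun hx' => ht' (eq_of_mem_satClass_of_mem_satClass hx' hx)) _

/-- Outside `K` every class indicator vanishes. [cite: SerreLinearRepresentations1977, §2.1] -/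
theorem indicator_satClass_apply_of_notMem {t : ConjClasses (K ⧸ N.subgroupOf K)} {x : G} (hx : x ∉ K) :
    {z : G | ∃ h : z ∈ K, ConjClasses.mk ((⟨z, h⟩ : K) : K ⧸ N.subgroupOf K) = t}.indicator (1 : G → R) x = 0 :=
  Set.indicator_of_notMem (fun h => hx h.1) _

/-- EVALUATION recovers the coefficients: `(Σ_{t'} c t' • 1_{S t'}) x = c t` for `x ∈ S t` (any finitely indexed family of classes).
[cite: SerreLinearRepresentations1977, §2.5] -/
theorem sum_smul_indicator_satClass_apply [Fintype (ConjClasses (K ⧸ N.subgroupOf K))]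
    (c : ConjClasses (K ⧸ N.subgroupOf K) → R) {t : ConjClasses (K ⧸ N.subgroupOf K)} {x : G}
    (hx : x ∈ {z : G | ∃ h : z ∈ K, ConjClasses.mk ((⟨z, h⟩ : K) : K ⧸ N.subgroupOf K) = t}) :
    (∑ t' : ConjClasses (K ⧸ N.subgroupOf K),
        c t' • {z : G | ∃ h : z ∈ K, ConjClasses.mk ((⟨z, h⟩ : K) : K ⧸ N.subgroupOf K) = t'}.indicator (1 : G → R)) x = c t := by
  rw [Finset.sum_apply, Finset.sum_eq_single t]
  · rw [Pi.smul_apply, smul_eq_mul, Set.indicator_of_mem hx, Pi.one_apply, mul_one]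
  · intro t' _ ht'
    rw [Pi.smul_apply, smul_eq_mul, indicator_satClass_apply_of_mem_of_ne hx ht', mul_zero]
  · intro h
    exact absurd (Finset.mem_univ t) h

/-- Outside `K` the class sum vanishes. [cite: SerreLinearRepresentations1977, §2.5] -/
theorem sum_smul_indicator_satClass_apply_of_notMem [Fintype (ConjClasses (K ⧸ N.subgroupOf K))]
    (c : ConjClasses (K ⧸ N.subgroupOf K) → R) {x : G} (hx : x ∉ K) :
    (∑ t' : ConjClasses (K ⧸ N.subgroupOf K),
        c t' • {z : G | ∃ h : z ∈ K, ConjClasses.mk ((⟨z, h⟩ : K) : K ⧸ N.subgroupOf K) = t'}.indicator (1 : G → R)) x = 0 := by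
  rw [Finset.sum_apply]
  refine Finset.sum_eq_zero fun t' _ => ?_
  rw [Pi.smul_apply, smul_eq_mul, indicator_satClass_apply_of_notMem hx, mul_zero]

/-- **CLASS DECOMPOSITION, POINTWISE, NO FINITENESS**: if `support f ⊆ K`, `f` right-`N`-invariant and `Ad(K)`-invariant, then for every `x`
`f x = ∑ᶠ t, f (rep t) * 1_{S t} x` (at most one term is non-zero). [cite: SerreLinearRepresentations1977, §2.5] -/
theorem eq_finsum_indicator_satClass_apply {f : G → R} (hsupp : support f ⊆ (K : Set G))
    (hright : ∀ n ∈ N, ∀ x, f (x * n) = f x) (hAd : ∀ k ∈ K, ∀ x, f (k * x * k⁻¹) = f x) (x : G) :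
    f x = ∑ᶠ t : ConjClasses (K ⧸ N.subgroupOf K),
      f ((Quotient.out (Quotient.out t) : K) : G) *
        {z : G | ∃ h : z ∈ K, ConjClasses.mk ((⟨z, h⟩ : K) : K ⧸ N.subgroupOf K) = t}.indicator (1 : G → R) x := by
  by_cases hxK : x ∈ K
  · set t₀ : ConjClasses (K ⧸ N.subgroupOf K) := ConjClasses.mk ((⟨x, hxK⟩ : K) : K ⧸ N.subgroupOf K) with ht₀
    have hx₀ : x ∈ {z : G | ∃ h : z ∈ K, ConjClasses.mk ((⟨z, h⟩ : K) : K ⧸ N.subgroupOf K) = t₀} := ⟨hxK, rfl⟩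
    rw [finsum_eq_single _ t₀]
    · rw [Set.indicator_of_mem hx₀, Pi.one_apply, mul_one]
      exact apply_eq_apply_out_out hright hAd hx₀
    · intro t ht
      rw [indicator_satClass_apply_of_mem_of_ne hx₀ ht, mul_zero]
  · have hfx : f x = 0 := by
      by_contra h
      exact hxK (hsupp (mem_support.2 h))
    rw [hfx, eq_comm]
    refine finsum_eq_zero_of_forall_eq_zero fun t => ?_
    rw [indicator_satClass_apply_of_notMem hxK, mul_zero]

/-- **CLASS DECOMPOSITION for ANY system of representatives** `r t ∈ S t` (finitely indexed classes): `f = Σ_t f (r t) • 1_{S t}`.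
[cite: SerreLinearRepresentations1977, §2.5] -/
theorem eq_sum_smul_indicator_satClass_of_forall_mem [Fintype (ConjClasses (K ⧸ N.subgroupOf K))] {f : G → R}
    (hsupp : support f ⊆ (K : Set G)) (hright : ∀ n ∈ N, ∀ x, f (x * n) = f x) (hAd : ∀ k ∈ K, ∀ x, f (k * x * k⁻¹) = f x)
    (r : ConjClasses (K ⧸ N.subgroupOf K) → G)
    (hr : ∀ t, r t ∈ {z : G | ∃ h : z ∈ K, ConjClasses.mk ((⟨z, h⟩ : K) : K ⧸ N.subgroupOf K) = t}) :
    f = ∑ t : ConjClasses (K ⧸ N.subgroupOf K),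
      f (r t) • {z : G | ∃ h : z ∈ K, ConjClasses.mk ((⟨z, h⟩ : K) : K ⧸ N.subgroupOf K) = t}.indicator (1 : G → R) := by
  funext x
  by_cases hxK : x ∈ K
  · have hx₀ : x ∈ {z : G | ∃ h : z ∈ K, ConjClasses.mk ((⟨z, h⟩ : K) : K ⧸ N.subgroupOf K) =
        ConjClasses.mk ((⟨x, hxK⟩ : K) : K ⧸ N.subgroupOf K)} := ⟨hxK, rfl⟩
    rw [sum_smul_indicator_satClass_apply (fun t => f (r t)) hx₀]
    exact apply_eq_apply_of_mem_satClass hright hAd hx₀ (hr _)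
  · have hfx : f x = 0 := by
      by_contra h
      exact hxK (hsupp (mem_support.2 h))
    rw [hfx, sum_smul_indicator_satClass_apply_of_notMem _ hxK]

/-- **CLASS DECOMPOSITION (A-75 HEAD).**  `G` a group, `N ≤ K` subgroups with `N` normalised by `K` (`[(N.subgroupOf K).Normal]`) and finitely many classes
in `K ⧸ N′` (`[Fintype (ConjClasses (K ⧸ N.subgroupOf K))]`, e.g. from `Finite (K ⧸ N′)`); `f : G → R` with `support f ⊆ K`, right-`N`-invariant and
`Ad(K)`-invariant.  Then `f = Σ_{t : ConjClasses (K ⧸ N′)} f (rep t) • 1_{S t}` with `S t := {x | ∃ h : x ∈ K, ConjClasses.mk (↑⟨x, h⟩ : K ⧸ N′) = t}` and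
`rep t := ↑(Quotient.out (Quotient.out t))`. [cite: SerreLinearRepresentations1977, §2.5] -/
theorem eq_sum_smul_indicator_satClass [Fintype (ConjClasses (K ⧸ N.subgroupOf K))] {f : G → R}
    (hsupp : support f ⊆ (K : Set G)) (hright : ∀ n ∈ N, ∀ x, f (x * n) = f x) (hAd : ∀ k ∈ K, ∀ x, f (k * x * k⁻¹) = f x) :
    f = ∑ t : ConjClasses (K ⧸ N.subgroupOf K),
      f ((Quotient.out (Quotient.out t) : K) : G) •
        {x : G | ∃ h : x ∈ K, ConjClasses.mk ((⟨x, h⟩ : K) : K ⧸ N.subgroupOf K) = t}.indicator (1 : G → R) :=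
  eq_sum_smul_indicator_satClass_of_forall_mem hsupp hright hAd _ out_out_mem_satClass

/-- The pieces are of the same kind (1): `support 1_{S t} ⊆ K`. [cite: SerreLinearRepresentations1977, §2.1] -/
theorem support_indicator_satClass_subset (t : ConjClasses (K ⧸ N.subgroupOf K)) :
    support ({z : G | ∃ h : z ∈ K, ConjClasses.mk ((⟨z, h⟩ : K) : K ⧸ N.subgroupOf K) = t}.indicator (1 : G → R)) ⊆ (K : Set G) :=
  (Set.support_indicator_subset).trans (subset_of_mem_satClass t)

/-- The pieces are of the same kind (2): `1_{S t}` is RIGHT-`N`-INVARIANT (`N ≤ K`). [cite: SerreLinearRepresentations1977, §2.1] -/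
theorem indicator_satClass_mul_right (hNK : N ≤ K) (t : ConjClasses (K ⧸ N.subgroupOf K)) {n : G} (hn : n ∈ N) (x : G) :
    {z : G | ∃ h : z ∈ K, ConjClasses.mk ((⟨z, h⟩ : K) : K ⧸ N.subgroupOf K) = t}.indicator (1 : G → R) (x * n) =
      {z : G | ∃ h : z ∈ K, ConjClasses.mk ((⟨z, h⟩ : K) : K ⧸ N.subgroupOf K) = t}.indicator (1 : G → R) x := by
  by_cases hx : x ∈ {z : G | ∃ h : z ∈ K, ConjClasses.mk ((⟨z, h⟩ : K) : K ⧸ N.subgroupOf K) = t}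
  · rw [Set.indicator_of_mem hx, Set.indicator_of_mem (mul_mem_satClass hNK hx hn), Pi.one_apply, Pi.one_apply]
  · rw [Set.indicator_of_notMem hx, Set.indicator_of_notMem]
    intro hxn
    have h := mul_mem_satClass hNK hxn (N.inv_mem hn)
    rw [mul_inv_cancel_right] at h
    exact hx h

/-- The pieces are of the same kind (3): `1_{S t}` is `Ad(K)`-INVARIANT. [cite: SerreLinearRepresentations1977, §2.1] -/
theorem indicator_satClass_conj (t : ConjClasses (K ⧸ N.subgroupOf K)) {k : G} (hk : k ∈ K) (x : G) :
    {z : G | ∃ h : z ∈ K, ConjClasses.mk ((⟨z, h⟩ : K) : K ⧸ N.subgroupOf K) = t}.indicator (1 : G → R) (k * x * k⁻¹) =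
      {z : G | ∃ h : z ∈ K, ConjClasses.mk ((⟨z, h⟩ : K) : K ⧸ N.subgroupOf K) = t}.indicator (1 : G → R) x := by
  by_cases hx : x ∈ {z : G | ∃ h : z ∈ K, ConjClasses.mk ((⟨z, h⟩ : K) : K ⧸ N.subgroupOf K) = t}
  · rw [Set.indicator_of_mem hx, Set.indicator_of_mem (conj_mem_satClass hx hk), Pi.one_apply, Pi.one_apply]
  · rw [Set.indicator_of_notMem hx, Set.indicator_of_notMem]
    intro hxk
    have h := conj_mem_satClass hxk (K.inv_mem hk)
    rw [inv_inv, ← mul_assoc, ← mul_assoc, inv_mul_cancel, one_mul, mul_assoc, inv_mul_cancel, mul_one] at h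
    exact hx h

end Decomposition

/-! ## §3 Topology: the saturated classes are clopen (and compact), the pieces are locally constant with compact support -/

section ClopenIndicator

variable {X : Type*} [TopologicalSpace X] {R : Type*} [Zero R]

/-- The indicator of a CLOPEN set (times any constant) is LOCALLY CONSTANT. [cite: BernsteinZelevinsky1976, §1.1] -/
theorem isLocallyConstant_indicator_const_of_isClopen {S : Set X} (hS : IsClopen S) (c : R) :
    IsLocallyConstant (S.indicator fun _ => c) := by
  rw [IsLocallyConstant.iff_eventually_eq]
  intro x
  by_cases hx : x ∈ S
  · filter_upwards [hS.2.mem_nhds hx] with y hy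
    rw [Set.indicator_of_mem hy, Set.indicator_of_mem hx]
  · filter_upwards [hS.1.isOpen_compl.mem_nhds hx] with y hy
    rw [Set.indicator_of_notMem hy, Set.indicator_of_notMem hx]

end ClopenIndicator

section Topology

variable [TopologicalSpace G] [IsTopologicalGroup G] [hN : (N.subgroupOf K).Normal]

/-- If `N` is OPEN (and `N ≤ K`) every saturated class is OPEN (`x ∈ S t ⇒ x·N ⊆ S t`). [cite: BernsteinZelevinsky1976, §1.1] -/
theorem isOpen_satClass (hNK : N ≤ K) (hNo : IsOpen (N : Set G)) (t : ConjClasses (K ⧸ N.subgroupOf K)) :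
    IsOpen {z : G | ∃ h : z ∈ K, ConjClasses.mk ((⟨z, h⟩ : K) : K ⧸ N.subgroupOf K) = t} := by
  rw [isOpen_iff_mem_nhds]
  intro x hx
  have hcont : Continuous fun y : G => x⁻¹ * y := continuous_const.mul continuous_id
  have hopen : IsOpen ((fun y : G => x⁻¹ * y) ⁻¹' (N : Set G)) := hNo.preimage hcont
  refine Filter.mem_of_superset (hopen.mem_nhds (by simp [N.one_mem])) fun y hy => ?_
  have h := mul_mem_satClass hNK hx hy
  rwa [mul_inv_cancel_left] at h

/-- If `N` is OPEN (and `N ≤ K`) every saturated class is CLOSED (`K` is an open, hence closed, subgroup and `S t = K ∖ ⋃_{t' ≠ t} S t'`).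
[cite: BernsteinZelevinsky1976, §1.1] -/
theorem isClosed_satClass (hNK : N ≤ K) (hNo : IsOpen (N : Set G)) (t : ConjClasses (K ⧸ N.subgroupOf K)) :
    IsClosed {z : G | ∃ h : z ∈ K, ConjClasses.mk ((⟨z, h⟩ : K) : K ⧸ N.subgroupOf K) = t} := by
  have hKo : IsOpen (K : Set G) := Subgroup.isOpen_mono hNK hNo
  have hKc : IsClosed (K : Set G) := K.isClosed_of_isOpen hKo
  have hU : IsOpen (⋃ t' : {t' : ConjClasses (K ⧸ N.subgroupOf K) // t' ≠ t},
      {z : G | ∃ h : z ∈ K, ConjClasses.mk ((⟨z, h⟩ : K) : K ⧸ N.subgroupOf K) = t'.1}) :=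
    isOpen_iUnion fun t' => isOpen_satClass hNK hNo t'.1
  have hEq : {z : G | ∃ h : z ∈ K, ConjClasses.mk ((⟨z, h⟩ : K) : K ⧸ N.subgroupOf K) = t} =
      (K : Set G) \ ⋃ t' : {t' : ConjClasses (K ⧸ N.subgroupOf K) // t' ≠ t},
        {z : G | ∃ h : z ∈ K, ConjClasses.mk ((⟨z, h⟩ : K) : K ⧸ N.subgroupOf K) = t'.1} := by
    apply Set.Subset.antisymm
    · intro z hz
      refine ⟨hz.1, fun hzU => ?_⟩
      obtain ⟨t', ht'⟩ := Set.mem_iUnion.1 hzU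
      exact t'.2 (eq_of_mem_satClass_of_mem_satClass ht' hz)
    · rintro z ⟨hzK, hzU⟩
      refine ⟨hzK, ?_⟩
      by_contra hne
      exact hzU (Set.mem_iUnion.2 ⟨⟨ConjClasses.mk ((⟨z, hzK⟩ : K) : K ⧸ N.subgroupOf K), hne⟩, hzK, rfl⟩)
  rw [hEq]
  exact hKc.sdiff hU

/-- If `N` is OPEN (and `N ≤ K`) every saturated class is CLOPEN. [cite: BernsteinZelevinsky1976, §1.1] -/
theorem isClopen_satClass (hNK : N ≤ K) (hNo : IsOpen (N : Set G)) (t : ConjClasses (K ⧸ N.subgroupOf K)) :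
    IsClopen {z : G | ∃ h : z ∈ K, ConjClasses.mk ((⟨z, h⟩ : K) : K ⧸ N.subgroupOf K) = t} :=
  ⟨isClosed_satClass hNK hNo t, isOpen_satClass hNK hNo t⟩

/-- If `N` is open and `K` is COMPACT every saturated class is COMPACT. [cite: BernsteinZelevinsky1976, §1.1] -/
theorem isCompact_satClass (hNK : N ≤ K) (hNo : IsOpen (N : Set G)) (hKc : IsCompact (K : Set G))
    (t : ConjClasses (K ⧸ N.subgroupOf K)) :
    IsCompact {z : G | ∃ h : z ∈ K, ConjClasses.mk ((⟨z, h⟩ : K) : K ⧸ N.subgroupOf K) = t} :=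
  hKc.of_isClosed_subset (isClosed_satClass hNK hNo t) (subset_of_mem_satClass t)

variable {R : Type*} [Zero R]

/-- If `N` is open, each piece `1_{S t}` is LOCALLY CONSTANT. [cite: BernsteinZelevinsky1976, §1.1] -/
theorem isLocallyConstant_indicator_satClass [One R] (hNK : N ≤ K) (hNo : IsOpen (N : Set G))
    (t : ConjClasses (K ⧸ N.subgroupOf K)) :
    IsLocallyConstant ({z : G | ∃ h : z ∈ K, ConjClasses.mk ((⟨z, h⟩ : K) : K ⧸ N.subgroupOf K) = t}.indicator (1 : G → R)) :=
  isLocallyConstant_indicator_const_of_isClopen (isClopen_satClass hNK hNo t) 1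

/-- If `N` is open and `K` compact, each piece `1_{S t}` has COMPACT SUPPORT. [cite: BernsteinZelevinsky1976, §1.1] -/
theorem hasCompactSupport_indicator_satClass [One R] (hNK : N ≤ K) (hNo : IsOpen (N : Set G)) (hKc : IsCompact (K : Set G))
    (t : ConjClasses (K ⧸ N.subgroupOf K)) :
    HasCompactSupport ({z : G | ∃ h : z ∈ K, ConjClasses.mk ((⟨z, h⟩ : K) : K ⧸ N.subgroupOf K) = t}.indicator (1 : G → R)) :=
  HasCompactSupport.intro' (isCompact_satClass hNK hNo hKc t) (isClosed_satClass hNK hNo t)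
    fun _ hx => Set.indicator_of_notMem hx _

end Topology

end Literature.GroupTheory
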